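import Mathlib
import Summits.ResolutionOfSingularities.ResolutionOfSingularities.Theorems.HomologicalConductorPersistenceSurfaceCompletedStepLevelFree
import Summits.ResolutionOfSingularities.ResolutionOfSingularities.Theorems.HomologicalConductorPersistenceSurfaceCompletedStepSingular
import HarnessLib

/-!
# Rung S-2 `PersistenceSurface` (stmt-ResolutionOfSingularities-19970) — w44b-o12′/o12″ bookkeeping:
# the LEVEL-FREE completed-step conjecture CSP‴ REDUCES TO THE STEPS INTO A SINGULAR STAGE

Route `ResolutionOfSingularities/HomologicalConductor`, chain W4.4b (cell `res-hironaka`), rung S-2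
`PersistenceSurface` (stmt-ResolutionOfSingularities-19970); the level-free door of record is res-type-011's
`persistenceSurface_of_residual₃_of_completedStep'_of_rest'` (p521182) over the typed conjecture
`CompletedStepPersistenceRationalNormal'` (CSP‴: `ca⁴(T_m) ↦ ca(T̂_(m+1))`). OURS; nothing here is a statement
of the manuscript under review (Hironaka 2017); AI-written, weaker than expert review. Filed
`--supports stmt-ResolutionOfSingularities-19970 --as helper` by res-type-010 (o12′ hand; res-type-011 10:01:40Z
noted the fact for the vacuity pass: «at a regular target stage both CSP″ and CSP‴ are trivial»).

* `completedStepPersistenceRationalNormal'_of_singularSteps` — the level-free twin of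
  `completedStepPersistenceRationalNormal_of_singularSteps` (`…CompletedStepSingular`, p520924): along the tower
  every stage has Krull dimension `≤ 2`, so at a step whose target `T_(m+1)` is a REGULAR local ring every
  element of `T̂_(m+1)` already lies in `ca⁴(T̂_(m+1)) ⊆ ca(T̂_(m+1))` (Serre at the completion,
  `mem_cohomologyAnnihilatorOfDegree_four_adicCompletion_of_isRegularLocalRing` + `cohomologyAnnihilatorOfDegree_le`);
  hence **CSP‴ follows from its restriction to the steps INTO a non-regular stage** — the typed conjecture's
  content is located at singular target stages only, kernel-certified for the level-free door as well.

References: res-L1-w44b-plan-1 CHAIN w44b v12.3 §V12.9 (o12′ / o12″) (OURS); S. B. Iyengar, R. Takahashi, IMRN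
2016, Example 2.5 — context for the facts cited by name.
-/

set_option linter.dupNamespace false -- mandated namespace `Summit.<Summit>.<Problem>` of this single-conjunct summit

noncomputable section

namespace Summit.ResolutionOfSingularities.ResolutionOfSingularities.Theorems.HomologicalConductor.PersistenceSurfaceCompletedStep

open IsLocalRing Literature.RingTheory.CohomologyAnnihilator
open Summit.ResolutionOfSingularities.ResolutionOfSingularities.Theorems.NoZeno.Birth
open Summit.ResolutionOfSingularities.ResolutionOfSingularities.Theorems.HomologicalConductor.PersistenceSurfaceTowerDim
open Summit.ResolutionOfSingularities.ResolutionOfSingularities.Theorems.HomologicalConductor.PersistenceSurfaceCompletedStepLevelFree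

variable {k K : Type} [Field k] [Field K] [Algebra k K]

/-- **CSP‴ REDUCES TO THE STEPS INTO A SINGULAR STAGE (OURS · w44b-o12′/o12″ bookkeeping).** Along the
canonical normalised `ca`-tower of a surface datum (binders verbatim those of
`CompletedStepPersistenceRationalNormal'`) every stage has Krull dimension `≤ 2`
(`ringKrullDim_tower_le_of_ringKrullDim_le`), so at a step `T_m → T_(m+1)` with `T_(m+1)` REGULAR the level-free
completed clause holds by Serre at the completion (`ca⁴(T̂_(m+1)) = ⊤`, then `ca⁴ ⊆ ca`). Hence the typed
conjecture CSP‴ follows from its restriction to the steps whose target stage is NOT regular. [folklore] -/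
theorem completedStepPersistenceRationalNormal'_of_singularSteps
    (h : ∀ p : ℕ, p.Prime → ∀ (k K : Type) [Field k] [CharP k p] [Field K] [Algebra k K]
      (O : ValuationSubring K) (A : Subalgebra k K), (∀ c : k, algebraMap k K c ∈ O) → A.FG →
      IsFractionRing ↥A K → A.toSubring ≤ O.toSubring → ringKrullDim ↥A ≤ 2 →
      ((IsIntegrallyClosed ↥(tower O A 0) ∧
          Literature.AlgebraicGeometry.Resolution.HasRationalSingularity ↥(tower O A 0)) ∨
        IsRegularLocalRing ↥(tower O A 0)) →
      ∀ (m : ℕ) (hle : tower O A m ≤ tower O A (m + 1))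
        [IsNoetherianRing ↥(tower O A (m + 1))] [IsLocalRing ↥(tower O A (m + 1))],
        ¬ IsRegularLocalRing ↥(tower O A (m + 1)) →
        ∀ (x : ↥(tower O A m)), x ∈ cohomologyAnnihilatorOfDegree ↥(tower O A m) 4 →
        algebraMap ↥(tower O A (m + 1))
            (AdicCompletion (IsLocalRing.maximalIdeal ↥(tower O A (m + 1))) ↥(tower O A (m + 1)))
            (Subalgebra.inclusion hle x) ∈
          cohomologyAnnihilator
            (AdicCompletion (IsLocalRing.maximalIdeal ↥(tower O A (m + 1))) ↥(tower O A (m + 1)))) :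
    CompletedStepPersistenceRationalNormal' := by
  intro p hp k K _ _ _ _ O A hk hA hfr hAO hdim hRN m hle _ _ x hx
  by_cases hreg : IsRegularLocalRing ↥(tower O A (m + 1))
  · haveI : IsFractionRing ↥A K := hfr
    have hd2 : ringKrullDim ↥(tower O A (m + 1)) ≤ (2 : ℕ) :=
      ringKrullDim_tower_le_of_ringKrullDim_le O A hA (by exact_mod_cast hdim) (m + 1)
    exact cohomologyAnnihilatorOfDegree_le 4
      (algebraMap_mem_cohomologyAnnihilatorOfDegree_four_adicCompletion_of_isRegularLocalRing
        (hd2.trans (by exact_mod_cast (by norm_num : (2 : ℕ) ≤ 3))) _)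
  · exact h p hp k K O A hk hA hfr hAO hdim hRN m hle hreg x hx

/-- **Corollary: CSP‴ from the SINGULAR steps of CSP″.** If the level-four completed clause holds at every step
into a NON-regular stage, then the level-free conjecture CSP‴ holds at every step (Serre at regular targets,
`ca⁴ ⊆ ca` at the others). [folklore] -/
theorem completedStepPersistenceRationalNormal'_of_singularSteps_levelFour
    (h : ∀ p : ℕ, p.Prime → ∀ (k K : Type) [Field k] [CharP k p] [Field K] [Algebra k K]
      (O : ValuationSubring K) (A : Subalgebra k K), (∀ c : k, algebraMap k K c ∈ O) → A.FG →
      IsFractionRing ↥A K → A.toSubring ≤ O.toSubring → ringKrullDim ↥A ≤ 2 →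
      ((IsIntegrallyClosed ↥(tower O A 0) ∧
          Literature.AlgebraicGeometry.Resolution.HasRationalSingularity ↥(tower O A 0)) ∨
        IsRegularLocalRing ↥(tower O A 0)) →
      ∀ (m : ℕ) (hle : tower O A m ≤ tower O A (m + 1))
        [IsNoetherianRing ↥(tower O A (m + 1))] [IsLocalRing ↥(tower O A (m + 1))],
        ¬ IsRegularLocalRing ↥(tower O A (m + 1)) →
        ∀ (x : ↥(tower O A m)), x ∈ cohomologyAnnihilatorOfDegree ↥(tower O A m) 4 →
        algebraMap ↥(tower O A (m + 1))
            (AdicCompletion (IsLocalRing.maximalIdeal ↥(tower O A (m + 1))) ↥(tower O A (m + 1)))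
            (Subalgebra.inclusion hle x) ∈
          cohomologyAnnihilatorOfDegree
            (AdicCompletion (IsLocalRing.maximalIdeal ↥(tower O A (m + 1))) ↥(tower O A (m + 1))) 4) :
    CompletedStepPersistenceRationalNormal' :=
  completedStep'_of_completedStep (completedStepPersistenceRationalNormal_of_singularSteps h)

end Summit.ResolutionOfSingularities.ResolutionOfSingularities.Theorems.HomologicalConductor.PersistenceSurfaceCompletedStep

end
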